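import Summits.ValiantsHypothesis.ValiantsHypothesis.Theses.TwistedDetRank
import Literature.Computability.AlgebraicComplexity.BLMW11WeakValiantHypothesis
import Literature.Computability.AlgebraicComplexity.GenMatrixPoly
import Literature.Computability.AlgebraicComplexity.VPDeterminantalQPProofs
import Summits.ValiantsHypothesis.ValiantsHypothesis.Theorems.MonotoneRestorationMultilinearRestorationQPValues
import Literature.Computability.AlgebraicComplexity.DetInVP

/-!
# `TwistedDetRank.SliceVPInVBP` (stmt-ValiantsHypothesis-17992, X2a) — calibration: where the item sits

X2a says: for class functions `χ_n` on `S_n`, if the generalised-matrix-function family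
`f_n = Σ_σ χ_n(σ) Π_i X_{σ(i),i}` is p-computable over `ℂ` then `dc(f_n)` is p-bounded
("the class-function slice of `VP` lies in `VBP = VP_ws`").

This file kernel-checks the LOGICAL POSITION of X2a relative to the two named open hypotheses of
the field (all theorems unconditional, no named facts assumed):

* `sliceVPInVBP_of_not_dcPerSuperpolynomial` — **`¬ DcPerSuperpolynomial ℂ → SliceVPInVBP`**: in the
  world `VNP ⊆ VP_ws` (p-bounded `dc(per_m)`) X2a holds, because a p-computable GMF family is in
  `VP ⊆ VNP`, hence a p-projection of the permanent (Valiant, `isVNPComplete_perPoly_holds ℂ`), hence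
  in `VP_ws` (`vnp_subset_vpws_iff_isPProjection_perPoly_detPoly`), and `dc ≤ 12·L_ws + 1`
  (`hasDetRepr_of_wsComplexity_le`).  Contrapositive `dcPerSuperpolynomial_of_not_sliceVPInVBP`:
  **a refutation of X2a is a proof of Valiant's weak hypothesis `VNP ⊄ VP_ws`** (BLMW 2011 §9.2),
  and `sliceVPInVBP_or_dcPerSuperpolynomial`: `X2a ∨ DcPerSuperpolynomial ℂ` outright.
* `valiantsHypothesis_of_sliceVPInVBP_of_dcPerSuperpolynomial` — **`SliceVPInVBP →
  DcPerSuperpolynomial ℂ → ValiantsHypothesis`** (the strategist's calibration of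
  `Cruxes/FermionicNormalForm/SplitVBP.lean`, made importable): **a proof of X2a is a proof of the
  transfer "weak Valiant hypothesis ⇒ Valiant's hypothesis"**, whose converse is the known direction
  (`dcPerSuperpolynomial_of_perNotPComputableComplex`).
* `sliceVPInVBP_iff_not_dcPerSuperpolynomial_of_not_vh` — in every world where `VP ℂ = VNP ℂ`, X2a is
  EXACTLY `VNP ⊆ VP_ws`; `sliceVPInVBP_iff` — `X2a ↔ (DcPerSuperpolynomial ℂ → VH ∧ X2a)`-free form:
  `X2a ↔ (¬ DcPerSuperpolynomial ℂ ∨ (ValiantsHypothesis ∧ SliceVPInVBP))`.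
* `sliceVP_dc_isQPBounded` — the unconditional content available today: on the slice (as on all of
  `VP`) `dc(f_n)` is quasi-polynomially bounded (`isQPBounded_determinantalComplexity_of_isVPFamily_holds`,
  BCS 1997 Cor. (21.40)); so X2a is precisely the poly-vs-quasipoly gap of `dc` on the slice.

HONEST FRAMING: nothing here proves or refutes X2a; it shows that either would settle a named open
problem (`VNP ⊄ VP_ws`, resp. `VNP ⊄ VP_ws ⇒ VNP ⊄ VP`).  `VP ≠ VNP` is not moved by this file.

References: Bürgisser 2000 §2.5, Rem. 2.11; Malod–Portier 2008 Thm 6/8; BLMW 2011 §9.2;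
Mignon–Ressayre 2004 §1; BCS 1997 (21.40).
-/

-- single-conjunct layout: Sub = Summit, duplicated namespace component intended
set_option linter.dupNamespace false

noncomputable section

namespace Summit.ValiantsHypothesis.ValiantsHypothesis.Theorems.TwistedDetRankSliceVPInVBP

open MvPolynomial Literature.Computability.AlgebraicComplexity
open Summit.ValiantsHypothesis.ValiantsHypothesis.Theses.TwistedDetRank
open scoped BigOperators

/-! ## §0 The slice family is a `VP` family iff it is p-computable -/

/-- The inlined GMF of the route file is `genMatrixPoly (χ n)` (by `rfl`). [folklore] -/
theorem gmf_eq_genMatrixPoly (χ : (n : ℕ) → Equiv.Perm (Fin n) → ℂ) (n : ℕ) :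
    (∑ σ : Equiv.Perm (Fin n), C (χ n σ) *
        ∏ i : Fin n, (X (σ i, i) : MvPolynomial (Fin n × Fin n) ℂ)) = genMatrixPoly (χ n) :=
  rfl

/-- A p-computable GMF family is a `VP` family (the p-family condition — `n²` variables, degree
`≤ n` — is automatic, `isPFamily_genMatrixPoly`). [cite: Burgisser2000, Def. 2.3–2.4] -/
theorem isVPFamily_gmf_of_isPComputable (χ : (n : ℕ) → Equiv.Perm (Fin n) → ℂ)
    (hc : IsPComputable (fun n => ∑ σ : Equiv.Perm (Fin n), C (χ n σ) *
        ∏ i : Fin n, (X (σ i, i) : MvPolynomial (Fin n × Fin n) ℂ))) :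
    IsVPFamily (fun n => ∑ σ : Equiv.Perm (Fin n), C (χ n σ) *
        ∏ i : Fin n, (X (σ i, i) : MvPolynomial (Fin n × Fin n) ℂ)) :=
  (isVPFamily_genMatrixPoly_iff χ).2 hc

/-! ## §1 World `VNP ⊆ VP_ws` gives X2a -/

/-- `12 r + 1` is p-bounded in `n` when `r ≤ n ^ c + c`. [folklore] -/
theorem isPBounded_twelve_mul_add_one (c : ℕ) :
    IsPBounded fun n => 3 * (4 * (n ^ c + c)) + 1 :=
  IsPBounded.add_holds (IsPBounded.mul_holds (IsPBounded.const 3) (IsPBounded.mul_holds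
    (IsPBounded.const 4) (IsPBounded.add_holds (IsPBounded.pow_holds IsPBounded.id c)
    (IsPBounded.const c)))) (IsPBounded.const 1)

/-- In the world `VNP ⊆ VP_ws` every `VP` family in the variables `Fin n × Fin n` has p-bounded
weakly-skew complexity (transport along `Fin n × Fin n ≃ Fin (n·n)`, `VP ⊆ VNP`, and the class
form `vnp_subset_vpws_iff_isPProjection_perPoly_detPoly` of BLMW 2011 §9.2).
[cite: BurgisserEtAl2011, §9.2] -/
theorem isVPwsFamily_of_isVPFamily_of_not_dcPerSuperpolynomial (hW : ¬ DcPerSuperpolynomial ℂ)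
    {f : (n : ℕ) → MvPolynomial (Fin n × Fin n) ℂ} (hf : IsVPFamily f) : IsVPwsFamily f := by
  have hws : IsVPwsFamily (fun m => perPoly (Fin m) ℂ) := by
    by_contra hn
    exact hW (dcPerSuperpolynomial_iff_not_isVPwsFamily_perPoly.mpr hn)
  have H := vnp_subset_vpws_iff_isPProjection_perPoly_detPoly.mpr
    (isVPwsFamily_perPoly_iff_isPProjection_detPoly.mp hws)
  have hVNP : IsVNPFamily f := IsVPFamily.isVNPFamily_holds' hf
  have hVNP' : IsVNPFamily (fun n => rename (finProdFinEquiv (m := n) (n := n)) (f n)) := by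
    have h := (isVNPFamily_renameEquiv_iff (σ := fun n => Fin n × Fin n)
      (fun n => finProdFinEquiv (m := n) (n := n)) f).2 hVNP
    simpa only [renameEquiv_apply] using h
  have h := H (fun n => n * n) _ hVNP'
  unfold IsVPwsFamily at h ⊢
  simpa only [wsComplexity_rename_equiv] using h

/-- **World W1 gives X2a: `¬ DcPerSuperpolynomial ℂ → SliceVPInVBP`.** If `dc(per_m)` is p-bounded
(`VNP ⊆ VP_ws`), then every p-computable class-function GMF family has p-bounded `dc`: it is a `VP`
family, hence in `VP_ws` (`isVPwsFamily_of_isVPFamily_of_not_dcPerSuperpolynomial`), and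
`dc ≤ 12·L_ws + 1` (`hasDetRepr_of_wsComplexity_le`).  The class-function hypothesis is not used.
[cite: BurgisserEtAl2011, §9.2] -/
theorem sliceVPInVBP_of_not_dcPerSuperpolynomial (hW : ¬ DcPerSuperpolynomial ℂ) : SliceVPInVBP := by
  intro χ _hχ hc
  obtain ⟨c, hcws⟩ :=
    isVPwsFamily_of_isVPFamily_of_not_dcPerSuperpolynomial hW (isVPFamily_gmf_of_isPComputable χ hc)
  obtain ⟨c', hc'⟩ := isPBounded_twelve_mul_add_one c
  exact ⟨c', fun n => ⟨3 * (4 * (n ^ c + c)) + 1, hc' n, hasDetRepr_of_wsComplexity_le _ (hcws n)⟩⟩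

/-- **A refutation of X2a proves Valiant's weak hypothesis `VNP ⊄ VP_ws`** (`DcPerSuperpolynomial ℂ`:
`dc(per_m)` is not p-bounded) — contrapositive of `sliceVPInVBP_of_not_dcPerSuperpolynomial`.
[cite: BurgisserEtAl2011, §9.2] -/
theorem dcPerSuperpolynomial_of_not_sliceVPInVBP (h : ¬ SliceVPInVBP) : DcPerSuperpolynomial ℂ :=
  Classical.byContradiction fun hW => h (sliceVPInVBP_of_not_dcPerSuperpolynomial hW)

/-- **`SliceVPInVBP ∨ DcPerSuperpolynomial ℂ` holds outright**: at least one of X2a and Valiant's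
weak hypothesis is true. [this file] -/
theorem sliceVPInVBP_or_dcPerSuperpolynomial : SliceVPInVBP ∨ DcPerSuperpolynomial ℂ := by
  by_cases hW : DcPerSuperpolynomial ℂ
  · exact Or.inr hW
  · exact Or.inl (sliceVPInVBP_of_not_dcPerSuperpolynomial hW)

/-! ## §2 X2a plus the weak hypothesis gives the summit -/

/-- `per_n` is the generalised matrix function of the class function `χ ≡ 1`. [folklore] -/
theorem gmf_one_eq_perPoly (n : ℕ) :
    (∑ σ : Equiv.Perm (Fin n), C (1 : ℂ) *
        ∏ i : Fin n, (X (σ i, i) : MvPolynomial (Fin n × Fin n) ℂ)) = perPoly (Fin n) ℂ := by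
  simp [perPoly, Matrix.permanent]

/-- **X2a is the summit RELATIVE TO `VNP ⊄ VP_ws`**: `SliceVPInVBP → DcPerSuperpolynomial ℂ →
ValiantsHypothesis`.  Under `VP ℂ = VNP ℂ` the permanent family is p-computable
(`isPComputable_perPoly_complex_iff`); it is the GMF of the class function `χ ≡ 1`; X2a bounds
its `dc` polynomially, contradicting the weak hypothesis.  So a PROOF of X2a is a proof of the open
transfer "`VNP ⊄ VP_ws ⇒ VNP ⊄ VP`" (the converse transfer is `dcPerSuperpolynomial_of_perNotPComputableComplex`).
Adapted from the strategist's `Cruxes/FermionicNormalForm/SplitVBP.lean` (not importable).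
[cite: Burgisser2000, Rem. 2.11] -/
theorem valiantsHypothesis_of_sliceVPInVBP_of_dcPerSuperpolynomial
    (hX2a : SliceVPInVBP) (hdc : DcPerSuperpolynomial ℂ) : _root_.ValiantsHypothesis := by
  show VP ℂ ≠ VNP ℂ
  intro hEq
  have hper : IsPComputable (fun n => perPoly (Fin n) ℂ) :=
    isPComputable_perPoly_complex_iff.2 hEq
  have hfun : (fun n => ∑ σ : Equiv.Perm (Fin n), C (1 : ℂ) *
        ∏ i : Fin n, (X (σ i, i) : MvPolynomial (Fin n × Fin n) ℂ)) =
      (fun n => perPoly (Fin n) ℂ) := funext gmf_one_eq_perPoly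
  have hcomp : IsPComputable (fun n => ∑ σ : Equiv.Perm (Fin n), C (1 : ℂ) *
        ∏ i : Fin n, (X (σ i, i) : MvPolynomial (Fin n × Fin n) ℂ)) := by
    rw [hfun]; exact hper
  obtain ⟨c, hc⟩ := hX2a (fun _ _ => (1 : ℂ)) (fun _ _ _ => rfl) hcomp
  apply hdc
  refine ⟨c, fun n => ?_⟩
  obtain ⟨m, hm, hA⟩ := hc n
  rw [gmf_one_eq_perPoly] at hA
  exact (determinantalComplexity_le_of_hasDetRepr hA).trans hm

/-- **X2a fails in world W2** (`VP ℂ = VNP ℂ` but `dc(per_m)` not p-bounded): contrapositive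
packaging of `valiantsHypothesis_of_sliceVPInVBP_of_dcPerSuperpolynomial`. [this file] -/
theorem not_sliceVPInVBP_of_not_vh_of_dcPerSuperpolynomial (hvh : ¬ _root_.ValiantsHypothesis)
    (hdc : DcPerSuperpolynomial ℂ) : ¬ SliceVPInVBP :=
  fun hX2a => hvh (valiantsHypothesis_of_sliceVPInVBP_of_dcPerSuperpolynomial hX2a hdc)

/-! ## §3 The exact position -/

/-- **In every world with `VP ℂ = VNP ℂ`, X2a is exactly `VNP ⊆ VP_ws`** (p-bounded `dc(per_m)`):
`→` by §2, `←` by §1. [this file] -/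
theorem sliceVPInVBP_iff_not_dcPerSuperpolynomial_of_not_vh (hvh : ¬ _root_.ValiantsHypothesis) :
    SliceVPInVBP ↔ ¬ DcPerSuperpolynomial ℂ :=
  ⟨fun hX2a hdc => hvh (valiantsHypothesis_of_sliceVPInVBP_of_dcPerSuperpolynomial hX2a hdc),
    sliceVPInVBP_of_not_dcPerSuperpolynomial⟩

/-- **Position of X2a**: `SliceVPInVBP ↔ ¬ DcPerSuperpolynomial ℂ ∨ (ValiantsHypothesis ∧ SliceVPInVBP)`
— X2a is TRUE in world W1 (`VNP ⊆ VP_ws`), FALSE in world W2 (`VP = VNP`, `VNP ⊄ VP_ws`), and in the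
`VP ≠ VNP` worlds it is the residual open question "`VP = VP_ws` on the class-function slice".
[this file] -/
theorem sliceVPInVBP_iff :
    SliceVPInVBP ↔ ¬ DcPerSuperpolynomial ℂ ∨ (_root_.ValiantsHypothesis ∧ SliceVPInVBP) := by
  constructor
  · intro hX2a
    by_cases hdc : DcPerSuperpolynomial ℂ
    · exact Or.inr ⟨valiantsHypothesis_of_sliceVPInVBP_of_dcPerSuperpolynomial hX2a hdc, hX2a⟩
    · exact Or.inl hdc
  · rintro (hdc | ⟨-, hX2a⟩)
    · exact sliceVPInVBP_of_not_dcPerSuperpolynomial hdc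
    · exact hX2a

/-! ## §4 What holds unconditionally: quasi-polynomial `dc` on the slice -/

/-- **Unconditional quasi-polynomial version of X2a** (`VP ⊆ VQP` in `dc`, BCS 1997 Cor. (21.40),
specialised to the slice): a p-computable class-function GMF family has `dc(f_n) ≤ 2^((log₂ n + c)^c)`.
So the content of X2a is exactly the polynomial-versus-quasipolynomial gap of `dc` on the slice.
The class-function hypothesis is not used.
[cite: BurgisserClausenShokrollahi1997, Cor. (21.40) with Thm. (21.27) and Thm. (21.33)] -/
theorem sliceVP_dc_isQPBounded (χ : (n : ℕ) → Equiv.Perm (Fin n) → ℂ)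
    (hc : IsPComputable (fun n => ∑ σ : Equiv.Perm (Fin n), C (χ n σ) *
        ∏ i : Fin n, (X (σ i, i) : MvPolynomial (Fin n × Fin n) ℂ))) :
    ∃ c : ℕ, ∀ n : ℕ, ∃ m ≤ 2 ^ ((Nat.log 2 n + c) ^ c),
      HasDetRepr (∑ σ : Equiv.Perm (Fin n), C (χ n σ) *
        ∏ i : Fin n, (X (σ i, i) : MvPolynomial (Fin n × Fin n) ℂ)) m := by
  obtain ⟨c, hcq⟩ := isQPBounded_determinantalComplexity_of_isVPFamily_holds _
    (isVPFamily_gmf_of_isPComputable χ hc)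
  exact ⟨c, fun n => ⟨_, hcq n, hasDetRepr_determinantalComplexity_holds _⟩⟩

/-! ## Appendix (2026-08-27, same seat): calibration of the registered stubs of line X2a

The registered skeleton `Cruxes/FermionicNormalForm/SplitVBPSkeletonX2a.lean` factors X2a through
syntactically multilinear circuits (tree `smCircuitSize`, Raz–Yehudayoff 2008 §2): `stub_smCollapse`
(p-computable ⇒ p-bounded `smCircuitSize`) and `stub_smToDetRepr` (p-bounded `smCircuitSize` ⇒
p-bounded `dc`).  With the stub statements written out VERBATIM as hypotheses (no new `def`):

* `det_smVP_of_smCollapse` — **`stub_smCollapse` gives polynomial-size syntactically multilinear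
  circuits for the DETERMINANT** (`det_n` is the GMF of the class function `sgn`; `DET ∈ VP`,
  `isVPFamily_detPoly_of_commRing`) — open since Raz–Yehudayoff 2008 (§1: no polynomial-size
  sm-circuit for `det_n` or `per_n` is known; record explicit sm-circuit lower bound
  `Ω(n^{4/3}/log² n)`, Raz–Shpilka–Yehudayoff 2008; `n^{Ω(log n)}` only for multilinear formulas);
  `per_smVP_of_smCollapse_of_not_vh`: the same for the permanent in any world with `VP ℂ = VNP ℂ`.
* `smToDetRepr_of_not_dcPerSuperpolynomial` — **`stub_smToDetRepr` holds in the world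
  `VNP ⊆ VP_ws`**; `dcPerSuperpolynomial_of_not_smToDetRepr` — **refuting it proves `VNP ⊄ VP_ws`**.
* `sliceVPInVBP_of_stubs` — the registered composition, for reference.
-/

/-! ## §5 (appended) `stub_smCollapse` puts the determinant (and, if `VP = VNP`, the permanent) in `smVP` -/

/-- The sign character (cast to `ℂ`) is a class function, in the route's spelling. [folklore] -/
theorem sign_conj_eq (n : ℕ) (σ τ : Equiv.Perm (Fin n)) :
    (((Equiv.Perm.sign (τ * σ * τ⁻¹) : ℤˣ) : ℤ) : ℂ) = (((Equiv.Perm.sign σ : ℤˣ) : ℤ) : ℂ) := by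
  have h : Equiv.Perm.sign (τ * σ * τ⁻¹) = Equiv.Perm.sign σ := by
    rw [Equiv.Perm.sign_mul, Equiv.Perm.sign_mul, Equiv.Perm.sign_inv, mul_right_comm,
      Int.units_mul_self, one_mul]
  rw [h]

/-- `det_n` is the generalised matrix function of the class function `sgn` (route spelling of
`genMatrixPoly_sign`). [cite: Curticapean2021, §1] -/
theorem gmf_sign_eq_detPoly (n : ℕ) :
    (∑ σ : Equiv.Perm (Fin n), C (((Equiv.Perm.sign σ : ℤˣ) : ℤ) : ℂ) *
        ∏ i : Fin n, (X (σ i, i) : MvPolynomial (Fin n × Fin n) ℂ)) = detPoly (Fin n) ℂ :=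
  genMatrixPoly_sign

/-- **`stub_smCollapse` ⇒ `DET ∈ smVP`**: if every p-computable class-function GMF family has
syntactically multilinear circuits of p-bounded size, then so does the determinant family (it is
the GMF of `sgn`, and `DET ∈ VP` by Berkowitz, `isVPFamily_detPoly_of_commRing`).  The conclusion
is an open problem (Raz–Yehudayoff 2008, §1). [cite: RazYehudayoff2008, §1–2] -/
theorem det_smVP_of_smCollapse
    (hA : ∀ χ : (n : ℕ) → Equiv.Perm (Fin n) → ℂ,
      (∀ (n : ℕ) (σ τ : Equiv.Perm (Fin n)), χ n (τ * σ * τ⁻¹) = χ n σ) →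
      IsPComputable (fun n => ∑ σ : Equiv.Perm (Fin n),
        C (χ n σ) * ∏ i : Fin n, (X (σ i, i) : MvPolynomial (Fin n × Fin n) ℂ)) →
      ∃ c : ℕ, ∀ n : ℕ, smCircuitSize (∑ σ : Equiv.Perm (Fin n),
        C (χ n σ) * ∏ i : Fin n, (X (σ i, i) : MvPolynomial (Fin n × Fin n) ℂ)) ≤
        ((n ^ c + c : ℕ) : ℕ∞)) :
    ∃ c : ℕ, ∀ n : ℕ, smCircuitSize (detPoly (Fin n) ℂ) ≤ ((n ^ c + c : ℕ) : ℕ∞) := by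
  have hfun : (fun n => ∑ σ : Equiv.Perm (Fin n), C (((Equiv.Perm.sign σ : ℤˣ) : ℤ) : ℂ) *
        ∏ i : Fin n, (X (σ i, i) : MvPolynomial (Fin n × Fin n) ℂ)) =
      (fun n => detPoly (Fin n) ℂ) := funext gmf_sign_eq_detPoly
  have hcomp : IsPComputable (fun n => ∑ σ : Equiv.Perm (Fin n),
      C (((Equiv.Perm.sign σ : ℤˣ) : ℤ) : ℂ) *
        ∏ i : Fin n, (X (σ i, i) : MvPolynomial (Fin n × Fin n) ℂ)) := by
    rw [hfun]; exact (isVPFamily_detPoly_of_commRing ℂ).2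
  obtain ⟨c, hc⟩ := hA (fun n σ => (((Equiv.Perm.sign σ : ℤˣ) : ℤ) : ℂ)) sign_conj_eq hcomp
  exact ⟨c, fun n => (gmf_sign_eq_detPoly n) ▸ hc n⟩

/-- **`stub_smCollapse` ⇒ (`VP ℂ = VNP ℂ` ⇒ `PER ∈ smVP`)**: in a world where Valiant's hypothesis
fails the permanent family is p-computable (`isPComputable_perPoly_complex_iff`) and is the GMF of
`χ ≡ 1`, so the stub gives it syntactically multilinear circuits of p-bounded size (no
polynomial-size sm-circuit for `per_n` is known either, Raz–Yehudayoff 2008 §1).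
[cite: RazYehudayoff2008, §1–2] -/
theorem per_smVP_of_smCollapse_of_not_vh
    (hA : ∀ χ : (n : ℕ) → Equiv.Perm (Fin n) → ℂ,
      (∀ (n : ℕ) (σ τ : Equiv.Perm (Fin n)), χ n (τ * σ * τ⁻¹) = χ n σ) →
      IsPComputable (fun n => ∑ σ : Equiv.Perm (Fin n),
        C (χ n σ) * ∏ i : Fin n, (X (σ i, i) : MvPolynomial (Fin n × Fin n) ℂ)) →
      ∃ c : ℕ, ∀ n : ℕ, smCircuitSize (∑ σ : Equiv.Perm (Fin n),
        C (χ n σ) * ∏ i : Fin n, (X (σ i, i) : MvPolynomial (Fin n × Fin n) ℂ)) ≤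
        ((n ^ c + c : ℕ) : ℕ∞))
    (hvh : ¬ _root_.ValiantsHypothesis) :
    ∃ c : ℕ, ∀ n : ℕ, smCircuitSize (perPoly (Fin n) ℂ) ≤ ((n ^ c + c : ℕ) : ℕ∞) := by
  have hEq : VP ℂ = VNP ℂ := by
    by_contra h
    exact hvh h
  have hper : IsPComputable (fun n => perPoly (Fin n) ℂ) := isPComputable_perPoly_complex_iff.2 hEq
  have hfun : (fun n => ∑ σ : Equiv.Perm (Fin n), C (1 : ℂ) *
        ∏ i : Fin n, (X (σ i, i) : MvPolynomial (Fin n × Fin n) ℂ)) =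
      (fun n => perPoly (Fin n) ℂ) := funext gmf_one_eq_perPoly
  have hcomp : IsPComputable (fun n => ∑ σ : Equiv.Perm (Fin n), C (1 : ℂ) *
        ∏ i : Fin n, (X (σ i, i) : MvPolynomial (Fin n × Fin n) ℂ)) := by
    rw [hfun]; exact hper
  obtain ⟨c, hc⟩ := hA (fun _ _ => (1 : ℂ)) (fun _ _ _ => rfl) hcomp
  exact ⟨c, fun n => (gmf_one_eq_perPoly n) ▸ hc n⟩

/-! ## §6 (appended) `stub_smToDetRepr` holds in the world `VNP ⊆ VP_ws`; refuting it proves `VNP ⊄ VP_ws` -/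

/-- A family with p-bounded `smCircuitSize` is p-computable (an sm-circuit is a fan-in-two circuit,
`MultilinearRung.complexity_le_of_smCircuitSize_le`). [cite: RazYehudayoff2008, §2] -/
theorem isPComputable_of_smCircuitSize_le {f : (n : ℕ) → MvPolynomial (Fin n × Fin n) ℂ}
    (h : ∃ c : ℕ, ∀ n : ℕ, smCircuitSize (f n) ≤ ((n ^ c + c : ℕ) : ℕ∞)) : IsPComputable f := by
  obtain ⟨c, hc⟩ := h
  exact ⟨c, fun n => MultilinearRung.complexity_le_of_smCircuitSize_le (hc n)⟩

/-- **World `VNP ⊆ VP_ws` gives `stub_smToDetRepr`**: `¬ DcPerSuperpolynomial ℂ →` (p-bounded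
`smCircuitSize` on the slice ⇒ p-bounded `dc`), via `isPComputable_of_smCircuitSize_le` and
`sliceVPInVBP_of_not_dcPerSuperpolynomial`.  The class-function hypothesis is not used.
[cite: BurgisserEtAl2011, §9.2] -/
theorem smToDetRepr_of_not_dcPerSuperpolynomial (hW : ¬ DcPerSuperpolynomial ℂ) :
    ∀ χ : (n : ℕ) → Equiv.Perm (Fin n) → ℂ,
      (∀ (n : ℕ) (σ τ : Equiv.Perm (Fin n)), χ n (τ * σ * τ⁻¹) = χ n σ) →
      (∃ c : ℕ, ∀ n : ℕ, smCircuitSize (∑ σ : Equiv.Perm (Fin n),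
        C (χ n σ) * ∏ i : Fin n, (X (σ i, i) : MvPolynomial (Fin n × Fin n) ℂ)) ≤
        ((n ^ c + c : ℕ) : ℕ∞)) →
      ∃ c : ℕ, ∀ n : ℕ, ∃ m ≤ n ^ c + c,
        HasDetRepr (∑ σ : Equiv.Perm (Fin n),
          C (χ n σ) * ∏ i : Fin n, (X (σ i, i) : MvPolynomial (Fin n × Fin n) ℂ)) m :=
  fun χ hχ hsm => sliceVPInVBP_of_not_dcPerSuperpolynomial hW χ hχ
    (isPComputable_of_smCircuitSize_le hsm)

/-- **A refutation of `stub_smToDetRepr` is a proof of `VNP ⊄ VP_ws`** (`DcPerSuperpolynomial ℂ`).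
[cite: BurgisserEtAl2011, §9.2] -/
theorem dcPerSuperpolynomial_of_not_smToDetRepr
    (h : ¬ ∀ χ : (n : ℕ) → Equiv.Perm (Fin n) → ℂ,
      (∀ (n : ℕ) (σ τ : Equiv.Perm (Fin n)), χ n (τ * σ * τ⁻¹) = χ n σ) →
      (∃ c : ℕ, ∀ n : ℕ, smCircuitSize (∑ σ : Equiv.Perm (Fin n),
        C (χ n σ) * ∏ i : Fin n, (X (σ i, i) : MvPolynomial (Fin n × Fin n) ℂ)) ≤
        ((n ^ c + c : ℕ) : ℕ∞)) →
      ∃ c : ℕ, ∀ n : ℕ, ∃ m ≤ n ^ c + c,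
        HasDetRepr (∑ σ : Equiv.Perm (Fin n),
          C (χ n σ) * ∏ i : Fin n, (X (σ i, i) : MvPolynomial (Fin n × Fin n) ℂ)) m) :
    DcPerSuperpolynomial ℂ :=
  Classical.byContradiction fun hW => h (smToDetRepr_of_not_dcPerSuperpolynomial hW)

/-! ## §7 (appended) The registered composition -/

/-- The registered composition of line X2a: `stub_smCollapse → stub_smToDetRepr → SliceVPInVBP`
(both hypotheses written out; this is `SliceVPInVBP_of` of the skeleton). [this file] -/
theorem sliceVPInVBP_of_stubs
    (hA : ∀ χ : (n : ℕ) → Equiv.Perm (Fin n) → ℂ,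
      (∀ (n : ℕ) (σ τ : Equiv.Perm (Fin n)), χ n (τ * σ * τ⁻¹) = χ n σ) →
      IsPComputable (fun n => ∑ σ : Equiv.Perm (Fin n),
        C (χ n σ) * ∏ i : Fin n, (X (σ i, i) : MvPolynomial (Fin n × Fin n) ℂ)) →
      ∃ c : ℕ, ∀ n : ℕ, smCircuitSize (∑ σ : Equiv.Perm (Fin n),
        C (χ n σ) * ∏ i : Fin n, (X (σ i, i) : MvPolynomial (Fin n × Fin n) ℂ)) ≤
        ((n ^ c + c : ℕ) : ℕ∞))
    (hB : ∀ χ : (n : ℕ) → Equiv.Perm (Fin n) → ℂ,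
      (∀ (n : ℕ) (σ τ : Equiv.Perm (Fin n)), χ n (τ * σ * τ⁻¹) = χ n σ) →
      (∃ c : ℕ, ∀ n : ℕ, smCircuitSize (∑ σ : Equiv.Perm (Fin n),
        C (χ n σ) * ∏ i : Fin n, (X (σ i, i) : MvPolynomial (Fin n × Fin n) ℂ)) ≤
        ((n ^ c + c : ℕ) : ℕ∞)) →
      ∃ c : ℕ, ∀ n : ℕ, ∃ m ≤ n ^ c + c,
        HasDetRepr (∑ σ : Equiv.Perm (Fin n),
          C (χ n σ) * ∏ i : Fin n, (X (σ i, i) : MvPolynomial (Fin n × Fin n) ℂ)) m) :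
    SliceVPInVBP :=
  fun χ hχ hc => hB χ hχ (hA χ hχ hc)

end Summit.ValiantsHypothesis.ValiantsHypothesis.Theorems.TwistedDetRankSliceVPInVBP

end
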